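import Literature.Algebra.Homology.OrderedCechPairSystemLexResolvent
import Literature.Algebra.Homology.OrderedCechPairSystemComparison
import Literature.Algebra.Homology.OrderedCechSystemCone
import Literature.Algebra.Homology.OrderedCechSystemBicomplex
import HarnessLib

/-!
# `Hⁿ(Tot Č•,•(P)) ≅ Hⁿ(Č•(lexSystem P))`: the total Čech complex of a pair-system computes the Čech cohomology of the product cover
# (Stacks 0BEC, 01FG; Eilenberg–Zilber without acyclic models)

Layer `Literature/Algebra/Homology` (proved lemmas only; 0 `def`, 0 named facts, no instance, no notation; pure homological algebra over a commutative
ring `A`).  For EVERY pair-system `P : Finset ι ⥤ Finset κ ⥤ ModuleCat A` of `A`-modules (finite linearly ordered `ι`, `κ`; no sheaf, no field, no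
finiteness) the cohomology of the total complex of the ordered Čech bicomplex `Č•,•(P)` (`Algebra/Homology/OrderedCechPairSystem`) is canonically
isomorphic to the cohomology of the ordered Čech complex of the lexicographic system `T ↦ P (π₁T) (π₂T)` (`Algebra/Homology/OrderedCechLexSystem`, the
Čech complex of the product cover `(U_i × V_j)_{(i,j) ∈ ι ×ₗ κ}`):

* **`nonempty_homologyIso_total_lexSystem P n : Nonempty (Hⁿ(Tot Č•,•(P)) ≅ Hⁿ(Č•(lexSystem P)))`** and, for two systems `M`, `N`,
  **`nonempty_homologyIso_tensor_lexSystem`**: `Hⁿ(Č•(M) ⊗ Č•(N)) ≅ Hⁿ(Č•(lexSystem (M ⊠ N)))` (with `OrderedCechSystemBicomplex.totalTensorIso`).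

PROOF = the resolution criterion `OrderedCech.homologyIsoEmptyComplexOfSystems` (`Algebra/Homology/OrderedCechPairSystemComparison`) fed with the
lexicographic Čech resolvent `Q^q(s, t) = Čq(T ↦ P (s ∪ π₁T) (t ∪ π₂T))` of `Algebra/Homology/OrderedCechPairSystemLexResolvent`; its three hypotheses are
apex-vertex contractions (`Algebra/Homology/OrderedCechSystemCone`): (R) for `s`, `t` non-empty the lex system `T ↦ P (s ∪ π₁T) (t ∪ π₂T)` has the apex
`(i₀, j₀) ∈ s × t` (§2); (Cκ)/(Cι) the `κ`-system `t ↦ Čq(lexShift P s t)` resp. the `ι`-system `s ↦ Čq(lexShift P s ∅)` is a PRODUCT over the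
`q`-simplices `T` of the slices `t ↦ P (s ∪ π₁T) (t ∪ π₂T)` resp. `s ↦ P (s ∪ π₁T) (π₂T)` with apex `j₀ ∈ π₂T` resp. `i₀ ∈ π₁T`, and Čech-acyclicity of
a system of cochain-systems is checked slice by slice (§1, the pattern of `OrderedCechPairSystemColumnCriterion`).  The corner complex is
`Č•(lexShift P ∅ ∅) ≅ Č•(lexSystem P)` (`lexCornerIso`, `lexShiftEmptyIso`).

Consumer (cell `hodgecm-mathlib`, F-11/J3 Künneth packet, F0P1b-p04 F-K3): with the shuffle retraction `∇* ∘ ×′ = 𝟙` (`H(×′)` injective) and the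
finiteness of `Hⁿ(Č•(𝔚, 𝒪))` the cross product `H(×′)` is bijective in ALL degrees (surjective endomorphism of a finite module, Vasconcelos /
`Module.Finite.injective_of_surjective_endomorphism`, or `finrank` over a field) — Künneth surjectivity by dimension, road (S1′)-α.  Library only
(count-neutral); proves nothing about any crux, route or conjecture.  Mathlib searched (pin v4.32): `Functor.flip`, `evaluation`, `Iso.refl`,
`HomologicalComplex.homologyFunctor`, `Functor.mapIso`, `Finset.image_insert`, `Finset.union_insert`, `Finset.insert_eq_of_mem` (used); Mathlib has no
Čech complexes of systems of modules and no Eilenberg–Zilber theorem for them.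

## References

* The Stacks Project, Tag 0BEC (Künneth: the double Čech complex of two coverings computes the cohomology of the product), Tag 01FG, Tag 0133,
  Tag 0G6T. [StacksProject]
* U. Görtz, T. Wedhorn, *Algebraic Geometry II* (2023), Lemma 21.65, Def. 21.68, Prop. 21.69 (pp. 179–181). [GortzWedhorn2023]
* C. A. Weibel, *An introduction to homological algebra* (1994), 2.7.3, 5.6.2, 8.5.1 (Eilenberg–Zilber). [Weibel1994]
-/

universe u

open CategoryTheory CategoryTheory.Limits HomologicalComplex Finset

set_option backward.isDefEq.respectTransparency false

noncomputable section

namespace Literature.Algebra.Homology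

namespace OrderedCech

variable {A : Type u} [CommRing A] {ι κ : Type} [LinearOrder ι] [LinearOrder κ]

/-! ### §1 Čech-acyclicity of a system of cochain-systems is checked slice by slice -/

section Slices

variable {κ' : Type} [LinearOrder κ'] (R : Finset κ' ⥤ (Finset (ι ×ₗ κ) ⥤ ModuleCat.{u} A)) (q : ℤ)

/-- Zero-extension commutes with evaluation at a simplex `T`: for a `κ'`-cochain `y` of the system `u ↦ Čq(R u)` the `T`-component of
`y.ext0At u u'` is the zero-extension, in the slice `u ↦ (R u) T`, of `τ ↦ (y τ)_T`. [cite: GortzWedhorn2023, Def. 21.68 (p. 180)] -/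
theorem ext0At_cochains_apply {b : ℤ} (y : SysCochain (R ⋙ sysCochainFunctor A (ι ×ₗ κ) q) b) (u u' : Finset κ')
    (T : Simplex (ι ×ₗ κ) q) :
    (y.ext0At u u' : SysCochain (R.obj u') q) T =
      SysCochain.ext0At (M := R ⋙ (evaluation _ _).obj T.1) (fun τ : Simplex κ' b => (y τ : SysCochain (R.obj τ.1) q) T) u u' := by
  unfold SysCochain.ext0At
  split_ifs <;> rfl

/-- The augmentation of `u ↦ Čq(R u)` is, componentwise in `T`, the augmentation of the slice `u ↦ (R u) T` (`rfl`).
[cite: GortzWedhorn2023, Lemma 21.65 (p. 179)] -/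
theorem sysAugment_cochains_apply (g : SysCochain (R.obj ∅) q) (τ : Simplex κ' 0) (T : Simplex (ι ×ₗ κ) q) :
    (sysAugment (R ⋙ sysCochainFunctor A (ι ×ₗ κ) q) g τ : SysCochain (R.obj τ.1) q) T =
      sysAugment (R ⋙ (evaluation _ _).obj T.1) (g T) τ := rfl

/-- The Čech differential of `u ↦ Čq(R u)` is, componentwise in `T`, that of the slice `u ↦ (R u) T`. [cite: GortzWedhorn2023, Def. 21.68 (p. 180)] -/
theorem sysD_cochains_apply (b : ℤ) (x : SysCochain (R ⋙ sysCochainFunctor A (ι ×ₗ κ) q) b) (τ' : Simplex κ' (b + 1))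
    (T : Simplex (ι ×ₗ κ) q) :
    (sysD (R ⋙ sysCochainFunctor A (ι ×ₗ κ) q) b x τ' : SysCochain (R.obj τ'.1) q) T =
      sysD (R ⋙ (evaluation _ _).obj T.1) b (fun τ : Simplex κ' b => (x τ : SysCochain (R.obj τ.1) q) T) τ' := by
  rw [sysD_apply, sysD_apply, Finset.sum_apply]
  refine sum_congr rfl fun j _ => ?_
  rw [Pi.smul_apply, ext0At_cochains_apply]

/-- The differentials of `Č•(u ↦ Čq(R u))`, componentwise in `T`, are those of `Č•(u ↦ (R u) T)` (any pair of degrees).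
[cite: GortzWedhorn2023, Def. 21.68 (p. 180)] -/
theorem sysComplex_d_cochains_apply (i j : ℤ) (y : SysCochain (R ⋙ sysCochainFunctor A (ι ×ₗ κ) q) i) (τ : Simplex κ' j)
    (T : Simplex (ι ×ₗ κ) q) :
    ((((sysComplex (R ⋙ sysCochainFunctor A (ι ×ₗ κ) q)).d i j).hom y : SysCochain _ j) τ : SysCochain (R.obj τ.1) q) T =
      (((sysComplex (R ⋙ (evaluation _ _).obj T.1)).d i j).hom
        (fun τ : Simplex κ' i => (y τ : SysCochain (R.obj τ.1) q) T) : SysCochain _ j) τ := by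
  by_cases hij : i + 1 = j
  · subst hij
    rw [sysComplex_d, sysComplex_d]
    exact sysD_cochains_apply R q i y τ T
  · rw [(sysComplex (R ⋙ sysCochainFunctor A (ι ×ₗ κ) q)).shape i j hij, (sysComplex (R ⋙ (evaluation _ _).obj T.1)).shape i j hij]
    rfl

/-- **`ε` of `u ↦ Čq(R u)` is injective if every slice's is.** [cite: StacksProject, Tag 0133] [cite: GortzWedhorn2023, Lemma 21.65 (p. 179)] -/
theorem sysAugment_cochains_injective (h : ∀ T : Simplex (ι ×ₗ κ) q, Function.Injective (sysAugment (R ⋙ (evaluation _ _).obj T.1))) :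
    Function.Injective (sysAugment (R ⋙ sysCochainFunctor A (ι ×ₗ κ) q)) := by
  intro g g' hgg'
  funext T
  apply h T
  funext τ
  have := congr_fun (congr_fun hgg' τ) T
  rwa [sysAugment_cochains_apply, sysAugment_cochains_apply] at this

/-- **Every `0`-cocycle of `u ↦ Čq(R u)` is augmented if this holds slice by slice** (componentwise choice).
[cite: StacksProject, Tag 0133] [cite: GortzWedhorn2023, Lemma 21.65 (p. 179)] -/
theorem exists_sysAugment_cochains_eq
    (h : ∀ (T : Simplex (ι ×ₗ κ) q) (x : SysCochain (R ⋙ (evaluation _ _).obj T.1) 0),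
      sysD (R ⋙ (evaluation _ _).obj T.1) 0 x = 0 → ∃ g : (R ⋙ (evaluation _ _).obj T.1).obj ∅, sysAugment _ g = x)
    (x : SysCochain (R ⋙ sysCochainFunctor A (ι ×ₗ κ) q) 0) (hx : sysD (R ⋙ sysCochainFunctor A (ι ×ₗ κ) q) 0 x = 0) :
    ∃ g : (R ⋙ sysCochainFunctor A (ι ×ₗ κ) q).obj ∅, sysAugment _ g = x := by
  have hc : ∀ T : Simplex (ι ×ₗ κ) q, ∃ g : (R ⋙ (evaluation _ _).obj T.1).obj ∅,
      sysAugment (R ⋙ (evaluation _ _).obj T.1) g = fun τ => (x τ : SysCochain (R.obj τ.1) q) T := fun T =>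
    h T _ (funext fun τ' => by
      have := congr_fun (congr_fun hx τ') T
      rw [sysD_cochains_apply] at this
      exact this)
  choose g hg using hc
  exact ⟨fun T => g T, funext fun τ => funext fun T => by rw [sysAugment_cochains_apply]; exact congr_fun (hg T) τ⟩

/-- **`Č•(u ↦ Čq(R u))` is exact in degree `n ≥ 1` if every slice's complex is** (componentwise choice).
[cite: StacksProject, Tag 0133] [cite: GortzWedhorn2023, Def. 21.68 (p. 180)] -/
theorem exists_d_cochains_eq
    (h : ∀ (T : Simplex (ι ×ₗ κ) q) (n : ℤ), 1 ≤ n → ∀ x : SysCochain (R ⋙ (evaluation _ _).obj T.1) n,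
      ((sysComplex (R ⋙ (evaluation _ _).obj T.1)).d n (n + 1)).hom x = 0 →
        ∃ y : SysCochain (R ⋙ (evaluation _ _).obj T.1) (n - 1), ((sysComplex (R ⋙ (evaluation _ _).obj T.1)).d (n - 1) n).hom y = x)
    (n : ℤ) (hn : 1 ≤ n) (x : SysCochain (R ⋙ sysCochainFunctor A (ι ×ₗ κ) q) n)
    (hx : ((sysComplex (R ⋙ sysCochainFunctor A (ι ×ₗ κ) q)).d n (n + 1)).hom x = 0) :
    ∃ y : SysCochain (R ⋙ sysCochainFunctor A (ι ×ₗ κ) q) (n - 1),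
      ((sysComplex (R ⋙ sysCochainFunctor A (ι ×ₗ κ) q)).d (n - 1) n).hom y = x := by
  have hc : ∀ T : Simplex (ι ×ₗ κ) q, ∃ y : SysCochain (R ⋙ (evaluation _ _).obj T.1) (n - 1),
      ((sysComplex (R ⋙ (evaluation _ _).obj T.1)).d (n - 1) n).hom y =
        fun τ => (x τ : SysCochain (R.obj τ.1) q) T := fun T =>
    h T n hn _ (funext fun τ' => by
      have := congr_fun (congr_fun hx τ') T
      rw [sysComplex_d_cochains_apply] at this
      exact this)
  choose y hy using hc
  refine ⟨fun τ T => y T τ, funext fun τ => funext fun T => ?_⟩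
  rw [sysComplex_d_cochains_apply]
  exact congr_fun (hy T) τ

end Slices

/-! ### §2 Apex vertices of the lex-shifted systems and their slices -/

variable (P : Finset ι ⥤ Finset κ ⥤ ModuleCat.{u} A)

omit [LinearOrder ι] [LinearOrder κ] in
/-- A composite restriction of `P` along two EQUALITIES of index sets is bijective. [cite: GortzWedhorn2023, Def. 21.68 (p. 180)] -/
theorem bijective_restrict_of_eq {s₁ s₂ : Finset ι} {t₁ t₂ : Finset κ} (f : s₁ ⟶ s₂) (g : t₁ ⟶ t₂) (hs : s₁ = s₂) (ht : t₁ = t₂) :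
    Function.Bijective ((P.map f).app t₁ ≫ (P.obj s₂).map g).hom := by
  subst hs ht
  rw [Subsingleton.elim f (𝟙 s₁), Subsingleton.elim g (𝟙 t₁), P.map_id, NatTrans.id_app, (P.obj s₁).map_id, Category.comp_id]
  exact Function.bijective_id

/-- `π₁ (T ∪ {w}) = π₁T ∪ {w.1}`. [cite: StacksProject, Tag 0BEC] -/
theorem fstProj_insert (w : ι ×ₗ κ) (T : Finset (ι ×ₗ κ)) : fstProj (insert w T) = insert (ofLex w).1 (fstProj T) :=
  Finset.image_insert _ _ _

/-- `π₂ (T ∪ {w}) = π₂T ∪ {w.2}`. [cite: StacksProject, Tag 0BEC] -/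
theorem sndProj_insert (w : ι ×ₗ κ) (T : Finset (ι ×ₗ κ)) : sndProj (insert w T) = insert (ofLex w).2 (sndProj T) :=
  Finset.image_insert _ _ _

/-- **(R) apex.** For `i₀ ∈ s`, `j₀ ∈ t` the vertex `(i₀, j₀)` is an apex of the lex system `T ↦ P (s ∪ π₁T) (t ∪ π₂T)`: adjoining it to `T` changes
neither `s ∪ π₁T` nor `t ∪ π₂T`. [cite: StacksProject, Tag 0BEC] [cite: StacksProject, Tag 0G6T] -/
theorem bijective_lexShift_map_insert {s : Finset ι} {t : Finset κ} {i₀ : ι} {j₀ : κ} (hi : i₀ ∈ s) (hj : j₀ ∈ t)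
    (T : Finset (ι ×ₗ κ)) :
    Function.Bijective ((lexShift P s t).map (homOfLE (subset_insert (toLex (i₀, j₀)) T))).hom := by
  rw [lexSystem_map]
  refine bijective_restrict_of_eq P _ _ ?_ ?_
  · change s ∪ fstProj T = s ∪ fstProj (insert (toLex (i₀, j₀)) T)
    rw [fstProj_insert]
    simp only [ofLex_toLex]
    rw [union_insert, insert_eq_of_mem (mem_union_left _ hi)]
  · change t ∪ sndProj T = t ∪ sndProj (insert (toLex (i₀, j₀)) T)
    rw [sndProj_insert]
    simp only [ofLex_toLex]
    rw [union_insert, insert_eq_of_mem (mem_union_left _ hj)]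

/-- **(Cκ) apex.** For `j₀ ∈ π₂T` the vertex `j₀` is an apex of the slice `t ↦ P (s ∪ π₁T) (t ∪ π₂T)`. [cite: StacksProject, Tag 0BEC]
[cite: StacksProject, Tag 0G6T] -/
theorem bijective_sliceκ_map_insert (s : Finset ι) {T : Finset (ι ×ₗ κ)} {j₀ : κ} (hj : j₀ ∈ sndProj T) (t : Finset κ) :
    Function.Bijective (((lexShiftBifunctor P).obj s ⋙ (evaluation _ _).obj T).map (homOfLE (subset_insert j₀ t))).hom := by
  change Function.Bijective ((lexShiftMap P (subset_refl s) (subset_insert j₀ t)).app T).hom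
  rw [lexSystemMap_app, pairShiftMap_app_app]
  refine bijective_restrict_of_eq P _ _ rfl ?_
  rw [insert_union, insert_eq_of_mem (mem_union_right _ hj)]

/-- **(Cι) apex.** For `i₀ ∈ π₁T` the vertex `i₀` is an apex of the slice `s ↦ P (s ∪ π₁T) (t ∪ π₂T)`. [cite: StacksProject, Tag 0BEC]
[cite: StacksProject, Tag 0G6T] -/
theorem bijective_sliceι_map_insert (t : Finset κ) {T : Finset (ι ×ₗ κ)} {i₀ : ι} (hi : i₀ ∈ fstProj T) (s : Finset ι) :
    Function.Bijective (((lexShiftBifunctor P).flip.obj t ⋙ (evaluation _ _).obj T).map (homOfLE (subset_insert i₀ s))).hom := by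
  change Function.Bijective ((lexShiftMap P (subset_insert i₀ s) (subset_refl t)).app T).hom
  rw [lexSystemMap_app, pairShiftMap_app_app]
  refine bijective_restrict_of_eq P _ _ ?_ rfl
  rw [insert_union, insert_eq_of_mem (mem_union_right _ hi)]

omit [LinearOrder ι] in
/-- A point of a non-empty `T ⊆ ι ×ₗ κ` has its second coordinate in `π₂T`. [cite: StacksProject, Tag 0BEC] -/
theorem snd_choose_mem_sndProj {T : Finset (ι ×ₗ κ)} (hT : T.Nonempty) : (ofLex hT.choose).2 ∈ sndProj T :=
  snd_mem_sndProj hT.choose_spec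

omit [LinearOrder κ] in
/-- A point of a non-empty `T ⊆ ι ×ₗ κ` has its first coordinate in `π₁T`. [cite: StacksProject, Tag 0BEC] -/
theorem fst_choose_mem_fstProj {T : Finset (ι ×ₗ κ)} (hT : T.Nonempty) : (ofLex hT.choose).1 ∈ fstProj T :=
  fst_mem_fstProj hT.choose_spec

/-- `P s t → (lexShift P s t) ∅` is bijective (`s ∪ π₁∅ = s`, `t ∪ π₂∅ = t`). [cite: StacksProject, Tag 0BEC] -/
theorem bijective_toShiftEmpty (s : Finset ι) (t : Finset κ) : Function.Bijective (toShiftEmpty P s t).hom :=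
  bijective_restrict_of_eq P _ _ (by rw [fstProj_empty]; exact (union_empty s).symm) (by rw [sndProj_empty]; exact (union_empty t).symm)

/-! ### §3 The resolvent lives in degrees `≥ 0`; its hypotheses (R), (Cκ), (Cι) -/

/-- The resolvent lives in degrees `≥ 0` (no simplices of negative dimension). [cite: StacksProject, Tag 0133] -/
theorem isStrictlyGE_lexResolvent : (lexResolvent P).IsStrictlyGE 0 := by
  rw [CochainComplex.isStrictlyGE_iff]
  intro q hq
  haveI : IsEmpty (Simplex (ι ×ₗ κ) q) := isEmpty_simplex_of_neg hq
  rw [IsZero.iff_id_eq_zero]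
  ext s t g
  exact Subsingleton.elim (α := SysCochain (lexShift P s t) q) _ _

/-- **`ε ≫ d⁰ = 0`** (`sysD_sysAugment` in every member). [cite: GortzWedhorn2023, Lemma 21.65 (p. 179)]
[cite: StacksProject, Tag 0133] -/
theorem lexResolventAugment_d : lexResolventAugment P ≫ (lexResolvent P).d 0 1 = 0 := by
  ext s t x
  change sysD (lexShift P s t) 0 (sysAugment (lexShift P s t) ((toShiftEmpty P s t).hom x)) = 0
  exact sysD_sysAugment _ _

/-- **(R), injectivity**: `ε s t : P s t → Č⁰(lexShift P s t)` is injective for `s`, `t` non-empty. [cite: StacksProject, Tag 0BEC]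
[cite: StacksProject, Tag 0G6T] -/
theorem lexResolventAugment_injective (s : Finset ι) (t : Finset κ) (hs : s.Nonempty) (ht : t.Nonempty) :
    Function.Injective (((lexResolventAugment P).app s).app t).hom := by
  rw [lexResolventAugment_app_app, ModuleCat.hom_comp, LinearMap.coe_comp]
  exact (sysAugment_injective_of_apex fun T => bijective_lexShift_map_insert P hs.choose_spec ht.choose_spec T).comp
    (bijective_toShiftEmpty P s t).1

/-- **(R), degree `0`**: a `0`-cocycle of `Č•(lexShift P s t)` (`s`, `t` non-empty) comes from `P s t`. [cite: StacksProject, Tag 0BEC]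
[cite: StacksProject, Tag 0G6T] -/
theorem exists_lexResolventAugment_eq (s : Finset ι) (t : Finset κ) (hs : s.Nonempty) (ht : t.Nonempty)
    (x : (((lexResolvent P).X 0).obj s).obj t) (hx : ((((lexResolvent P).d 0 1).app s).app t).hom x = 0) :
    ∃ y : (P.obj s).obj t, (((lexResolventAugment P).app s).app t).hom y = x := by
  have hd : (((lexResolvent P).d 0 1).app s).app t = ModuleCat.ofHom (sysD (lexShift P s t) 0) := by
    rw [lexResolvent_d_app_app]; exact sysComplex_d _ 0
  rw [hd] at hx
  obtain ⟨g, hg⟩ := exists_sysAugment_eq_of_apex (fun T => bijective_lexShift_map_insert P hs.choose_spec ht.choose_spec T) x hx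
  obtain ⟨y, rfl⟩ := (bijective_toShiftEmpty P s t).2 g
  exact ⟨y, by rw [lexResolventAugment_app_app, ModuleCat.comp_apply]; exact hg⟩

/-- **(R), degrees `≥ 1`**: `Č•(lexShift P s t)` is exact in positive degrees for `s`, `t` non-empty. [cite: StacksProject, Tag 0BEC]
[cite: StacksProject, Tag 0G6T] -/
theorem exists_lexResolvent_d_eq (q : ℤ) (hq : 1 ≤ q) (s : Finset ι) (t : Finset κ) (hs : s.Nonempty) (ht : t.Nonempty)
    (x : (((lexResolvent P).X q).obj s).obj t) (hx : ((((lexResolvent P).d q (q + 1)).app s).app t).hom x = 0) :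
    ∃ y : (((lexResolvent P).X (q - 1)).obj s).obj t, ((((lexResolvent P).d (q - 1) q).app s).app t).hom y = x := by
  rw [lexResolvent_d_app_app] at hx ⊢
  exact exists_d_eq_of_apex (fun T => bijective_lexShift_map_insert P hs.choose_spec ht.choose_spec T) q hq x hx

/-- **(Cκ), injectivity** for the `κ`-system `t ↦ Čq(lexShift P s t)`. [cite: StacksProject, Tag 0BEC] [cite: StacksProject, Tag 0G6T] -/
theorem sysAugment_lexResolventX_injective (q : ℤ) (s : Finset ι) :
    Function.Injective (sysAugment (((lexResolvent P).X q).obj s)) :=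
  sysAugment_cochains_injective ((lexShiftBifunctor P).obj s) q fun T =>
    sysAugment_injective_of_apex fun t => bijective_sliceκ_map_insert P s (snd_choose_mem_sndProj T.2.1) t

/-- **(Cκ), degree `0`** for the `κ`-system `t ↦ Čq(lexShift P s t)`. [cite: StacksProject, Tag 0BEC] [cite: StacksProject, Tag 0G6T] -/
theorem exists_sysAugment_lexResolventX_eq (q : ℤ) (s : Finset ι) (x : SysCochain (((lexResolvent P).X q).obj s) 0)
    (hx : sysD (((lexResolvent P).X q).obj s) 0 x = 0) :
    ∃ g : (((lexResolvent P).X q).obj s).obj ∅, sysAugment (((lexResolvent P).X q).obj s) g = x :=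
  exists_sysAugment_cochains_eq ((lexShiftBifunctor P).obj s) q
    (fun T => exists_sysAugment_eq_of_apex fun t => bijective_sliceκ_map_insert P s (snd_choose_mem_sndProj T.2.1) t) x hx

/-- **(Cκ), degrees `≥ 1`** for the `κ`-system `t ↦ Čq(lexShift P s t)`. [cite: StacksProject, Tag 0BEC] [cite: StacksProject, Tag 0G6T] -/
theorem exists_d_lexResolventX_eq (q : ℤ) (s : Finset ι) (n : ℤ) (hn : 1 ≤ n) (x : SysCochain (((lexResolvent P).X q).obj s) n)
    (hx : ((sysComplex (((lexResolvent P).X q).obj s)).d n (n + 1)).hom x = 0) :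
    ∃ y : SysCochain (((lexResolvent P).X q).obj s) (n - 1), ((sysComplex (((lexResolvent P).X q).obj s)).d (n - 1) n).hom y = x :=
  exists_d_cochains_eq ((lexShiftBifunctor P).obj s) q
    (fun T => exists_d_eq_of_apex fun t => bijective_sliceκ_map_insert P s (snd_choose_mem_sndProj T.2.1) t) n hn x hx

/-- **(Cι), injectivity** for the `ι`-system `s ↦ Čq(lexShift P s ∅)`. [cite: StacksProject, Tag 0BEC] [cite: StacksProject, Tag 0G6T] -/
theorem sysAugment_lexResolventX_flip_injective (q : ℤ) :
    Function.Injective (sysAugment (((lexResolvent P).X q).flip.obj ∅)) :=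
  sysAugment_cochains_injective ((lexShiftBifunctor P).flip.obj ∅) q fun T =>
    sysAugment_injective_of_apex fun s => bijective_sliceι_map_insert P ∅ (fst_choose_mem_fstProj T.2.1) s

/-- **(Cι), degree `0`** for the `ι`-system `s ↦ Čq(lexShift P s ∅)`. [cite: StacksProject, Tag 0BEC] [cite: StacksProject, Tag 0G6T] -/
theorem exists_sysAugment_lexResolventX_flip_eq (q : ℤ) (x : SysCochain (((lexResolvent P).X q).flip.obj ∅) 0)
    (hx : sysD (((lexResolvent P).X q).flip.obj ∅) 0 x = 0) :
    ∃ g : (((lexResolvent P).X q).flip.obj ∅).obj ∅, sysAugment (((lexResolvent P).X q).flip.obj ∅) g = x :=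
  exists_sysAugment_cochains_eq ((lexShiftBifunctor P).flip.obj ∅) q
    (fun T => exists_sysAugment_eq_of_apex fun s => bijective_sliceι_map_insert P ∅ (fst_choose_mem_fstProj T.2.1) s) x hx

/-- **(Cι), degrees `≥ 1`** for the `ι`-system `s ↦ Čq(lexShift P s ∅)`. [cite: StacksProject, Tag 0BEC] [cite: StacksProject, Tag 0G6T] -/
theorem exists_d_lexResolventX_flip_eq (q n : ℤ) (hn : 1 ≤ n) (x : SysCochain (((lexResolvent P).X q).flip.obj ∅) n)
    (hx : ((sysComplex (((lexResolvent P).X q).flip.obj ∅)).d n (n + 1)).hom x = 0) :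
    ∃ y : SysCochain (((lexResolvent P).X q).flip.obj ∅) (n - 1),
      ((sysComplex (((lexResolvent P).X q).flip.obj ∅)).d (n - 1) n).hom y = x :=
  exists_d_cochains_eq ((lexShiftBifunctor P).flip.obj ∅) q
    (fun T => exists_d_eq_of_apex fun s => bijective_sliceι_map_insert P ∅ (fst_choose_mem_fstProj T.2.1) s) n hn x hx

/-! ### §4 The comparison -/

/-- **`Hⁿ(Tot Č•,•(P)) ≅ Hⁿ(Č•(lexSystem P))` for every pair-system `P`**: the total complex of the ordered Čech bicomplex and the ordered Čech complex
of the lexicographic (product-cover) system have canonically isomorphic cohomology in every degree (resolution criterion on the lexicographic Čech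
resolvent, transported along `lexCornerIso ≪≫ Č•(lexShiftEmptyIso)`). [cite: StacksProject, Tag 0BEC] [cite: StacksProject, Tag 0133]
[cite: Weibel1994, 5.6.2] -/
theorem nonempty_homologyIso_total_lexSystem (n : ℤ) :
    Nonempty (((sysBicomplex P).total (ComplexShape.up ℤ)).homology n ≅ (sysComplex (lexSystem P)).homology n) := by
  haveI := isStrictlyGE_lexResolvent P
  exact ⟨homologyIsoEmptyComplexOfSystems (lexResolventAugment P) (lexResolventAugment_d P)
      (lexResolventAugment_injective P) (exists_lexResolventAugment_eq P) (exists_lexResolvent_d_eq P)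
      (fun q s _ => sysAugment_lexResolventX_injective P q s) (fun q s _ => exists_sysAugment_lexResolventX_eq P q s)
      (fun q s _ => exists_d_lexResolventX_eq P q s) (sysAugment_lexResolventX_flip_injective P)
      (exists_sysAugment_lexResolventX_flip_eq P) (exists_d_lexResolventX_flip_eq P) n ≪≫
    (homologyFunctor _ _ n).mapIso (lexCornerIso P ≪≫ sysComplexMapIso (lexShiftEmptyIso P))⟩

/-- **`Hⁿ(Č•(M) ⊗ Č•(N)) ≅ Hⁿ(Č•(lexSystem (M ⊠ N)))`**: for two systems `M`, `N` on finite index sets the tensor product of their ordered Čech complexes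
(`= Tot Č•,•(M ⊠ N)`, `OrderedCechSystemBicomplex.totalTensorIso`) and the Čech complex of the lexicographic system of the product pair-system
`(s, t) ↦ M s ⊗ N t` — the Čech complex of the product cover with coefficients `M ⊠ N` — have isomorphic cohomology.  With the algebraic Künneth formula
for `Č•(M) ⊗ Č•(N)` over a field this is the Künneth formula of the product cover. [cite: StacksProject, Tag 0BEC] [cite: Weibel1994, 5.6.2] -/
theorem nonempty_homologyIso_tensor_lexSystem [Fintype ι] [Fintype κ] (M : Finset ι ⥤ ModuleCat.{u} A) (N : Finset κ ⥤ ModuleCat.{u} A)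
    (n : ℤ) :
    Nonempty ((HomologicalComplex.tensorObj (sysComplex M) (sysComplex N)).homology n ≅ (sysComplex (lexSystem (prodSystem M N))).homology n) := by
  obtain ⟨e⟩ := nonempty_homologyIso_total_lexSystem (prodSystem M N) n
  exact ⟨(homologyFunctor _ _ n).mapIso (totalTensorIso M N) ≪≫ e⟩

end OrderedCech

end Literature.Algebra.Homology

end
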